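import Summits.ResolutionOfSingularities.ResolutionOfSingularities.Theorems.PurelyInseparableDim4JointForestAssembly
import Summits.ResolutionOfSingularities.ResolutionOfSingularities.Theorems.PurelyInseparableDim4JointShapeSurvival
import HarnessLib

/-!
# Purely inseparable four-folds: the MONOTONE JOINT FOREST (brick S3 (c) «joint point∘coordinate chains», part 14 =
# stage (C3) of the tree's v2, cell `res-dim4-pi`)

[OURS · counted 0] (D-0157 DOOR 2; WORD #66 (4)(c), #74 (g); host item stmt-ResolutionOfSingularities-16155, helper).
Nothing here proves resolution of singularities in dimension ≥ 4 / characteristic `p`.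
A RULE `plan s S` (entries `(j, b, S″)`: the planned coordinate children, `S ⊆ S″`) and `leaves s S` (equimultiple pairs
left to the point regime) drive a FOREST of coordinate members (v1's data + typ-2 g3's translated SHAPE + hereditary
plan conditions + `Acc` of the child relation) and point members (typ-3 g2's format).
* **`exists_isMarkedResolution_of_joint_forest`** — every such configuration on an admissible prefix of `M₀` leads to
  a marked resolution of `M₀` (BGMW Def. 3.1.3): induction on `Acc (CutExpand child)` of the coordinate members'
  `(state, S)` multiset; base = g2's point forest; step = part 13's `joint_forest_step` (children, leaves) + part 11 /
  part 4 survival + g2's point survival, after `IsMultipleBlowup.blowup` along `vanishingIdeal c₁`.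
HONEST SCOPE: `S ⊆ S″` children only (FC-2 excluded); separation combinatorial per chart; `Acc` is a hypothesis.
AI-produced formalisation, weaker than expert review. bears_on: LADDER-RESOLUTION:D157-DOOR2 (res-dim4-pi · S3 (c) v2).
-/

set_option linter.dupNamespace false -- D-0017: single-problem summit path `Summit.<S>.<S>.…` by design

noncomputable section

open MvPolynomial Finset CategoryTheory AlgebraicGeometry Opposite TopologicalSpace
open AlgebraicGeometry.Scheme.IdealSheafData (ofIdealTop vanishingIdeal)

namespace Summit.ResolutionOfSingularities.ResolutionOfSingularities.Theorems.PIDim4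

open Literature.AlgebraicGeometry.Resolution
open Literature.AlgebraicGeometry.Resolution.Hauser2010
open Literature.AlgebraicGeometry.Resolution.AffinePointBlowup (P A γ coord Wtop ξ)

namespace Equimultiple

section Forest

variable {K : Type} [Field K] {p : ℕ} [hp : Fact p.Prime] [CharP K p]

omit hp [CharP K p] in
/-- An accessible element is not related to itself. [folklore] -/
theorem not_rel_self_of_acc {α : Type*} {r : α → α → Prop} {a : α} (h : Acc r a) : ¬ r a a := by
  induction h with | intro x _ ih => exact fun hx => ih x hx hx

/-- **THE MONOTONE JOINT FOREST.** See the module docstring.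
[cite: BierstoneGrigorievMilmanWlodarczyk2011, Def. 3.1.3; §4 Step 2b] [cite: Hauser2010, §§F–G]
[cite: Hironaka1964, Main Theorem I (the characteristic-zero statement whose analogue is asked)] -/
theorem exists_isMarkedResolution_of_joint_forest {X₀ : Scheme.{0}} [IsLocallyNoetherian X₀] [JacobsonSpace X₀]
    [IsAlgClosed K] [DecidableEq K] (M₀ : MarkedIdeal X₀) (hE : HasSNC M₀.boundary) (hmult : M₀.mult = p)
    (plan : State K → Finset (Fin 4) → Finset (Fin 4 × (Fin 4 → K) × Finset (Fin 4)))
    (leaves : State K → Finset (Fin 4) → Finset (Fin 4 × (Fin 4 → K)))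
    (T : Multiset (State K × Finset (Fin 4)))
    (hT : Acc (Relation.CutExpand (fun q' q : State K × Finset (Fin 4) =>
      (∃ e ∈ plan q.1 q.2, q' = (CentreBlowup.step p q.2 e.1 e.2.1 q.1, e.2.2)) ∧ q' ≠ q)) T) :
    ∀ (X' : Scheme.{0}) (σ : X' ⟶ X₀) (M' : MarkedIdeal X') (_ : IsMultipleBlowup M₀ σ M')
      (pts : Finset X') (st : X' → State K) (_ : ∀ x ∈ pts, IsClosed ({x} : Set X'))
      (_ : ∀ x ∈ pts, (st x).F ≠ 0 ∧
        Literature.Barriers.ResolutionOfSingularities.HauserPerlega.IsClean p (st x).F ∧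
        (p : ℕ∞) ≤ CentreBlowup.ordAlong (Finset.univ : Finset (Fin 4)) (st x).F ∧
        Acc (fun s' s : State K => Edge p Finset.univ s s') (st x) ∧
        (∀ s' : State K, Relation.ReflTransGen (fun a b : State K => Edge p Finset.univ a b) (st x) s' →
          {w' : blowup (Scheme.IdealSheafData.vanishingIdeal (AffinePointBlowup.C₀ 4 K)) |
            IsClosed ({w'} : Set (blowup (Scheme.IdealSheafData.vanishingIdeal (AffinePointBlowup.C₀ 4 K)))) ∧
            blowup.π (Scheme.IdealSheafData.vanishingIdeal (AffinePointBlowup.C₀ 4 K)) w' = ξ 4 K ∧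
            (p : ℕ∞) ≤ idealOrder ((⟨hypSheaf p s'.F, [], p⟩ : MarkedIdeal (P 4 K)).transform
              (blowup.π (Scheme.IdealSheafData.vanishingIdeal (AffinePointBlowup.C₀ 4 K)))
              (Scheme.IdealSheafData.vanishingIdeal (AffinePointBlowup.C₀ 4 K))).ideal w'}.Finite) ∧
        ∃ (Y : Scheme.{0}) (φ : Y ⟶ X') (ψ : Y ⟶ P 4 K) (_ : IsOpenImmersion φ) (_ : IsOpenImmersion ψ) (y : Y),
          φ y = x ∧ ψ y = ξ 4 K ∧ M'.ideal.comap φ = (hypSheaf p (st x).F).comap ψ)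
      (cms : Finset (Closeds X')) (cst : Closeds X' → State K) (ctr : Closeds X' → Finset (Fin 4))
      (_ : cms.val.map (fun c => (cst c, ctr c)) = T)
      (_ : ∀ c ∈ cms, (cst c).F ≠ 0 ∧
        Literature.Barriers.ResolutionOfSingularities.HauserPerlega.IsClean p (cst c).F ∧
        IsPermissibleCentre p (ctr c) (cst c).F ∧
        Scheme.IsRegular (vanishingIdeal c).subscheme ∧ HasSNCWith M'.boundary (vanishingIdeal c) ∧
        (∃ (Y : Scheme.{0}) (φ : Y ⟶ X') (ψ : Y ⟶ P 4 K) (_ : IsOpenImmersion φ) (_ : IsOpenImmersion ψ),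
          M'.ideal.comap φ = (hypSheaf p (cst c).F).comap ψ ∧
          (vanishingIdeal c).comap φ =
            (AffineCoordBlowup.𝓘Λ 4 K (insert 0 (Fin.succ '' ((ctr c : Finset (Fin 4)) : Set (Fin 4))))).comap ψ ∧
          (c : Set X') ⊆ Set.range φ ∧
          (AffineCoordBlowup.CΛ 4 K (insert 0 (Fin.succ '' ((ctr c : Finset (Fin 4)) : Set (Fin 4)))) : Set (P 4 K)) ⊆
            Set.range ψ ∧
          ∃ (idx : X'.IdealSheafData → Fin 4) (cst_ : X'.IdealSheafData → K),
            (∀ D ∈ M'.boundary,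
              ((D.support : Set X') ∩ φ '' (ψ ⁻¹'
                (AffineCoordBlowup.CΛ 4 K (insert 0 (Fin.succ '' ((ctr c : Finset (Fin 4)) : Set (Fin 4)))) :
                  Set (P 4 K)))).Nonempty →
              D.comap φ = (ofIdealTop (Ideal.span {(γ 4 K).symm (X (idx D).succ + C (cst_ D))})).comap ψ ∧
                (idx D ∈ ctr c → cst_ D = 0)) ∧
            (∀ D₁ ∈ M'.boundary, ∀ D₂ ∈ M'.boundary,
              ((D₁.support : Set X') ∩ φ '' (ψ ⁻¹'
                (AffineCoordBlowup.CΛ 4 K (insert 0 (Fin.succ '' ((ctr c : Finset (Fin 4)) : Set (Fin 4)))) :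
                  Set (P 4 K)))).Nonempty →
              ((D₂.support : Set X') ∩ φ '' (ψ ⁻¹'
                (AffineCoordBlowup.CΛ 4 K (insert 0 (Fin.succ '' ((ctr c : Finset (Fin 4)) : Set (Fin 4)))) :
                  Set (P 4 K)))).Nonempty →
              idx D₁ = idx D₂ → D₁ = D₂)) ∧
        (∀ q : State K × Finset (Fin 4),
          Relation.ReflTransGen (fun q q' : State K × Finset (Fin 4) =>
            ∃ e ∈ plan q.1 q.2, q' = (CentreBlowup.step p q.2 e.1 e.2.1 q.1, e.2.2)) (cst c, ctr c) q →
          (∀ e ∈ plan q.1 q.2, e.1 ∈ q.2 ∧ e.2.1 e.1 = 0 ∧ q.2 ⊆ e.2.2 ∧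
              CentreBlowup.IsEquimultiplePoint p q.2 e.1 e.2.1 q.1 ∧
              IsPermissibleCentre p e.2.2 (CentreBlowup.step p q.2 e.1 e.2.1 q.1).F) ∧
          (∀ e ∈ plan q.1 q.2, ∀ e' ∈ plan q.1 q.2, e ≠ e' →
              (e.1 = e'.1 ∧ ∃ i ∈ e.2.2, i ∈ e'.2.2 ∧ e.2.1 i ≠ e'.2.1 i) ∨
              (e.1 ≠ e'.1 ∧ ((e'.2.1 e.1 = 0 ∧ e.1 ∈ e'.2.2) ∨ (e.2.1 e'.1 = 0 ∧ e'.1 ∈ e.2.2)))) ∧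
          (∀ l ∈ leaves q.1 q.2, CentreBlowup.IsEquimultiplePoint p q.2 l.1 l.2 q.1 →
              Acc (fun s' s : State K => Edge p Finset.univ s s') (CentreBlowup.step p q.2 l.1 l.2 q.1) ∧
              ∀ s' : State K, Relation.ReflTransGen (fun a e : State K => Edge p Finset.univ a e)
                  (CentreBlowup.step p q.2 l.1 l.2 q.1) s' →
                {jb : Fin 4 × (Fin 4 → K) | jb.2 jb.1 = 0 ∧
                  CentreBlowup.IsEquimultiplePoint p Finset.univ jb.1 jb.2 s'}.Finite) ∧
          (∀ (j' : Fin 4) (b' : Fin 4 → K), j' ∈ q.2 → b' j' = 0 →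
              CentreBlowup.IsEquimultiplePoint p q.2 j' b' q.1 →
              (∃ e ∈ plan q.1 q.2, e.1 = j' ∧ ∀ i ∈ e.2.2, b' i = e.2.1 i) ∨ (j', b') ∈ leaves q.1 q.2)) ∧
        Acc (fun q' q : State K × Finset (Fin 4) =>
          ∃ e ∈ plan q.1 q.2, q' = (CentreBlowup.step p q.2 e.1 e.2.1 q.1, e.2.2)) (cst c, ctr c))
      (_ : ∀ c ∈ cms, ∀ c' ∈ cms, c ≠ c' → Disjoint (c : Set X') (c' : Set X'))
      (_ : ∀ x ∈ pts, ∀ c ∈ cms, x ∉ (c : Set X'))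
      (_ : ∀ z : X', IsClosed ({z} : Set X') → (p : ℕ∞) ≤ idealOrder M'.ideal z →
        z ∈ pts ∨ ∃ c ∈ cms, z ∈ (c : Set X')),
      ∃ (X'' : Scheme.{0}) (ρ : X'' ⟶ X₀) (M'' : MarkedIdeal X''), IsMarkedResolution M₀ ρ M'' := by
  classical
  induction hT with
  | intro T _ ih =>
  intro X' σ M' hσ pts st hclosed hdata cms cst ctr hTeq hcdata hdisj₁ hdisj₂ hcover
  haveI : IsLocallyNoetherian X' := hσ.isLocallyNoetherian
  haveI : JacobsonSpace X' := jacobsonSpace_of_isMultipleBlowup hσ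
  have hmult' : M'.mult = p := hσ.mult_eq.trans hmult
  rcases cms.eq_empty_or_nonempty with hcms | ⟨c₁, hc₁⟩
  · -- no coordinate member: the point forest
    haveI : Std.Irrefl (fun s' s : State K => Edge p Finset.univ s s' ∧ s' ≠ s) := ⟨fun s hs => hs.2 rfl⟩
    have hTp : Acc (Relation.CutExpand (fun s' s : State K => Edge p Finset.univ s s' ∧ s' ≠ s))
        (pts.val.map st) := by
      refine Relation.acc_of_singleton fun s hs => ?_
      rw [Multiset.mem_map] at hs
      obtain ⟨x, hx, rfl⟩ := hs
      exact (Subrelation.accessible (fun hs => hs.1) (hdata x (Finset.mem_val.mp hx)).2.2.2.1).cutExpand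
    refine exists_isMarkedResolution_of_config_local M₀ hE hmult _ hTp X' σ M' hσ pts st rfl hclosed
      (fun z hz hzo => ?_) hdata
    rcases hcover z hz hzo with h | ⟨c, hc, -⟩
    · exact h
    · rw [hcms] at hc
      exact absurd hc (Finset.notMem_empty c)
  -- blow up the coordinate member `c₁` with its plan
  obtain ⟨hF₁, hclean₁, hS₁, hreg₁, hsnc₁, ⟨Y, φ, ψ, _, _, hM₁, hZ₁, hcφ₁, hsee₁, idx, cst_, hshape, hinj⟩,
    hplan₁, hacc₁⟩ := hcdata c₁ hc₁
  obtain ⟨hP1, hP2, hP3, hP5⟩ := hplan₁ (cst c₁, ctr c₁) Relation.ReflTransGen.refl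
  set s₁ := cst c₁ with hs₁
  set S₁ := ctr c₁ with hS₁def
  set Pl := plan s₁ S₁ with hPl; set L := leaves s₁ S₁ with hL
  set Ce : X'.IdealSheafData := vanishingIdeal c₁ with hCe
  have hπ : IsBlowup (blowup.π Ce) Ce := blowup.isBlowup Ce
  have hCsupp : ∀ z : X', z ∉ (Ce.support : Set X') ↔ z ∉ (c₁ : Set X') := fun z => by
    rw [hCe, Scheme.IdealSheafData.coe_support_vanishingIdeal]
  have himg := coe_member_eq_image φ ψ c₁ hZ₁ hcφ₁
  have hT₁ : IsClosed (φ '' (ψ ⁻¹' (AffineCoordBlowup.CΛ 4 K (insert 0 (Fin.succ '' (S₁ : Set (Fin 4)))) : Set (P 4 K)))) :=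
    himg ▸ c₁.isClosed
  have h₁ : IsMultipleBlowup M₀ (blowup.π Ce ≫ σ) (M'.transform (blowup.π Ce) Ce) :=
    IsMultipleBlowup.blowup hσ Ce (blowup.π Ce) hπ hreg₁
      (by rw [hCe, Scheme.IdealSheafData.coe_support_vanishingIdeal]
          exact coe_member_subset_support φ ψ M' hmult' _ hM₁ hS₁.2 c₁ hZ₁ hcφ₁) hsnc₁
  haveI : IsLocallyNoetherian (blowup Ce) := h₁.isLocallyNoetherian
  set M'' := M'.transform (blowup.π Ce) Ce with hM''
  have hM''I : M''.ideal = controlledTransform (blowup.π Ce) Ce M'.ideal M'.mult := rfl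
  -- the assembled step: children and leaves over `c₁`
  obtain ⟨kid, hkid, hkdisj, hkcover, hkfin⟩ := joint_forest_step φ ψ Ce hZ₁ hπ M' hmult' s₁ hM₁ hS₁ hsee₁ hT₁ hsnc₁
    idx cst_ hshape hinj Pl hP1 hP2 L hP5
  have hkid_over : ∀ e ∈ Pl, ∀ w ∈ (kid e : Set (blowup Ce)), blowup.π Ce w ∈ (c₁ : Set X') := fun e he w hw => by
    have h := (hkid e he).2.2.2.1 hw
    rwa [Set.mem_preimage, himg] at h
  have hkid_inj : ∀ e ∈ Pl, ∀ e' ∈ Pl, kid e = kid e' → e = e' := fun e he e' he' hee => by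
    by_contra hne
    obtain ⟨w, hw⟩ := (hkid e he).2.2.2.2
    exact Set.disjoint_left.mp (hkdisj e he e' he' hne) hw (by rw [← hee]; exact hw)
  -- leaf points: closed order-`p` points over `c₁` outside all children
  have hkfin' : {w : blowup Ce | IsClosed ({w} : Set (blowup Ce)) ∧ blowup.π Ce w ∈ (c₁ : Set X') ∧
      (p : ℕ∞) ≤ idealOrder M''.ideal w ∧ ∀ e ∈ Pl, w ∉ (kid e : Set (blowup Ce))}.Finite := by rwa [himg] at hkfin
  set ov : Finset (blowup Ce) := hkfin'.toFinset with hov_def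
  have hmem_over : ∀ w, w ∈ ov ↔ IsClosed ({w} : Set (blowup Ce)) ∧ blowup.π Ce w ∈ (c₁ : Set X') ∧
      (p : ℕ∞) ≤ idealOrder M''.ideal w ∧ ∀ e ∈ Pl, w ∉ (kid e : Set (blowup Ce)) := fun w => by
    rw [hov_def, Set.Finite.mem_toFinset, Set.mem_setOf_eq]
  have hleaf : ∀ w : blowup Ce, IsClosed ({w} : Set (blowup Ce)) → blowup.π Ce w ∈ (c₁ : Set X') →
      (p : ℕ∞) ≤ idealOrder M''.ideal w → (∀ e ∈ Pl, w ∉ (kid e : Set (blowup Ce))) →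
      ∃ l ∈ L, l.1 ∈ S₁ ∧ l.2 l.1 = 0 ∧ CentreBlowup.IsEquimultiplePoint p S₁ l.1 l.2 s₁ ∧
        ∃ (Y' : Scheme.{0}) (φ' : Y' ⟶ blowup Ce) (ψ' : Y' ⟶ P 4 K) (_ : IsOpenImmersion φ') (_ : IsOpenImmersion ψ')
          (y' : Y'), φ' y' = w ∧ ψ' y' = ξ 4 K ∧
          M''.ideal.comap φ' = (hypSheaf p (CentreBlowup.step p S₁ l.1 l.2 s₁).F).comap ψ' := by
    intro w hw hwc hord hout
    rw [← himg] at hwc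
    exact (hkcover w hw hwc hord).resolve_left fun ⟨e, he, hwe⟩ => hout e he hwe
  -- point survivors
  have hpre : ∀ z : {z // z ∈ pts}, ∃ w : blowup Ce, blowup.π Ce w = z.1 := fun z =>
    exists_eq_of_not_mem_support hπ ((hCsupp z.1).mpr (hdisj₂ z.1 z.2 c₁ hc₁))
  set pre : {z // z ∈ pts} → blowup Ce := fun z => (hpre z).choose with hpre_def
  have hπpre : ∀ z : {z // z ∈ pts}, blowup.π Ce (pre z) = z.1 := fun z => (hpre z).choose_spec
  have hpre_inj : Function.Injective pre := fun z z' hzz => Subtype.ext (by rw [← hπpre z, ← hπpre z', hzz])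
  set surv : Finset (blowup Ce) := pts.attach.image pre with hsurv_def
  have hmem_surv : ∀ w, w ∈ surv ↔ blowup.π Ce w ∈ pts := by
    intro w
    rw [hsurv_def, Finset.mem_image]
    refine ⟨by rintro ⟨z, -, rfl⟩; rw [hπpre z]; exact z.2, fun hw => ⟨⟨blowup.π Ce w, hw⟩, Finset.mem_attach _ _,
      eq_of_eq_of_not_mem_support hπ (hπpre _) (by rw [hπpre]; exact (hCsupp _).mpr (hdisj₂ _ hw c₁ hc₁))⟩⟩
  have hdisj_os : Disjoint ov surv := Finset.disjoint_left.mpr fun ⦃w⦄ hw hw' =>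
    hdisj₂ _ ((hmem_surv w).mp hw') c₁ hc₁ ((hmem_over w).mp hw).2.1
  set pts' : Finset (blowup Ce) := ov.disjUnion surv hdisj_os with hpts'
  have hmem' : ∀ w, w ∈ pts' ↔ w ∈ ov ∨ w ∈ surv := fun w => Finset.mem_disjUnion
  have hsurv_ord : ∀ w : blowup Ce, blowup.π Ce w ∉ (c₁ : Set X') →
      idealOrder M''.ideal w = idealOrder M'.ideal (blowup.π Ce w) := fun w hwx =>
    idealOrder_controlledTransform_eq_of_eq_of_not_mem_support hπ ((hCsupp _).mpr hwx) M'.ideal M'.mult rfl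
  set st' : blowup Ce → State K := fun w =>
    if hc : IsClosed ({w} : Set (blowup Ce)) ∧ blowup.π Ce w ∈ (c₁ : Set X') ∧
        (p : ℕ∞) ≤ idealOrder M''.ideal w ∧ ∀ e ∈ Pl, w ∉ (kid e : Set (blowup Ce)) then
      CentreBlowup.step p S₁ (hleaf w hc.1 hc.2.1 hc.2.2.1 hc.2.2.2).choose.1
        (hleaf w hc.1 hc.2.1 hc.2.2.1 hc.2.2.2).choose.2 s₁
    else st (blowup.π Ce w) with hst'
  have hover : ∀ w ∈ ov, ∃ l ∈ L, st' w = CentreBlowup.step p S₁ l.1 l.2 s₁ ∧ l.1 ∈ S₁ ∧ l.2 l.1 = 0 ∧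
      CentreBlowup.IsEquimultiplePoint p S₁ l.1 l.2 s₁ ∧
      ∃ (Y' : Scheme.{0}) (φ' : Y' ⟶ blowup Ce) (ψ' : Y' ⟶ P 4 K) (_ : IsOpenImmersion φ') (_ : IsOpenImmersion ψ')
        (y' : Y'), φ' y' = w ∧ ψ' y' = ξ 4 K ∧
        M''.ideal.comap φ' = (hypSheaf p (CentreBlowup.step p S₁ l.1 l.2 s₁).F).comap ψ' := by
    intro w hw
    have hc := (hmem_over w).mp hw
    obtain ⟨hl, hrest⟩ := (hleaf w hc.1 hc.2.1 hc.2.2.1 hc.2.2.2).choose_spec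
    exact ⟨_, hl, by rw [hst']; exact dif_pos hc, hrest⟩
  have hoff : ∀ w : blowup Ce, blowup.π Ce w ∉ (c₁ : Set X') → st' w = st (blowup.π Ce w) := fun w hwx => by
    rw [hst']; exact dif_neg fun hc => hwx hc.2.1
  -- coordinate survivors and children
  set prei : Closeds X' → Closeds (blowup Ce) := fun c => c.preimage (blowup.π Ce).continuous with hprei
  have hdisjC : ∀ c ∈ cms.erase c₁, Disjoint (c : Set X') (Ce.support : Set X') := by
    intro c hc
    rw [hCe, Scheme.IdealSheafData.coe_support_vanishingIdeal]
    exact hdisj₁ c (Finset.mem_of_mem_erase hc) c₁ hc₁ (Finset.ne_of_mem_erase hc)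
  have hprei_inj : Set.InjOn prei ↑(cms.erase c₁) := fun c hc c' hc' hcc => by
    have key : ∀ {d d' : Closeds X'}, d ∈ cms.erase c₁ → prei d = prei d' → (d : Set X') ⊆ (d' : Set X') := by
      intro d d' hd hdd x hx
      obtain ⟨w, hw⟩ := exists_eq_of_not_mem_support hπ (Set.disjoint_left.mp (hdisjC d hd) hx)
      have hw' : w ∈ (prei d : Set (blowup Ce)) := by change blowup.π Ce w ∈ (d : Set X'); rw [hw]; exact hx
      rw [hdd] at hw'
      change blowup.π Ce w ∈ (d' : Set X') at hw'
      rwa [hw] at hw'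
    exact Closeds.ext (Set.Subset.antisymm (key hc hcc) (key hc' hcc.symm))
  have hkid_ne_prei : ∀ e ∈ Pl, ∀ c ∈ cms.erase c₁, kid e ≠ prei c := fun e he c hc hec => by
    obtain ⟨w, hw⟩ := (hkid e he).2.2.2.2
    have h1 := hkid_over e he w hw
    rw [hec] at hw
    exact Set.disjoint_left.mp (hdisj₁ c (Finset.mem_of_mem_erase hc) c₁ hc₁ (Finset.ne_of_mem_erase hc)) hw h1
  set kidsF : Finset (Closeds (blowup Ce)) := Pl.image kid with hkidsF
  set survF : Finset (Closeds (blowup Ce)) := (cms.erase c₁).image prei with hsurvF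
  have hdisj_ks : Disjoint kidsF survF := Finset.disjoint_left.mpr fun ⦃d⦄ hd hd' => by
    obtain ⟨e, he, rfl⟩ := Finset.mem_image.mp hd
    obtain ⟨c, hc, hce⟩ := Finset.mem_image.mp hd'
    exact hkid_ne_prei e he c hc hce.symm
  set cms' : Finset (Closeds (blowup Ce)) := kidsF.disjUnion survF hdisj_ks with hcms'
  have hmem_cms' : ∀ d, d ∈ cms' ↔ (∃ e ∈ Pl, kid e = d) ∨ ∃ c ∈ cms.erase c₁, prei c = d := fun d => by
    rw [hcms', Finset.mem_disjUnion, hkidsF, hsurvF, Finset.mem_image, Finset.mem_image]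
  set cst' : Closeds (blowup Ce) → State K := fun d =>
    if h : ∃ e ∈ Pl, kid e = d then CentreBlowup.step p S₁ h.choose.1 h.choose.2.1 s₁
    else if h' : ∃ c ∈ cms.erase c₁, prei c = d then cst h'.choose else s₁ with hcst'
  set ctr' : Closeds (blowup Ce) → Finset (Fin 4) := fun d =>
    if h : ∃ e ∈ Pl, kid e = d then h.choose.2.2
    else if h' : ∃ c ∈ cms.erase c₁, prei c = d then ctr h'.choose else S₁ with hctr'
  have hkid_rep : ∀ e ∈ Pl, cst' (kid e) = CentreBlowup.step p S₁ e.1 e.2.1 s₁ ∧ ctr' (kid e) = e.2.2 := by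
    intro e he
    have h : ∃ e' ∈ Pl, kid e' = kid e := ⟨e, he, rfl⟩
    have hch : h.choose = e := hkid_inj _ h.choose_spec.1 e he h.choose_spec.2
    exact ⟨by simp only [hcst', dif_pos h]; rw [hch], by simp only [hctr', dif_pos h]; rw [hch]⟩
  have hsurv_rep : ∀ c ∈ cms.erase c₁, cst' (prei c) = cst c ∧ ctr' (prei c) = ctr c := by
    intro c hc
    have hn : ¬ ∃ e ∈ Pl, kid e = prei c := fun ⟨e, he, hec⟩ => hkid_ne_prei e he c hc hec
    have h' : ∃ c' ∈ cms.erase c₁, prei c' = prei c := ⟨c, hc, rfl⟩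
    have hch : h'.choose = c := hprei_inj h'.choose_spec.1 hc h'.choose_spec.2
    exact ⟨by simp only [hcst', dif_neg hn, dif_pos h']; rw [hch], by simp only [hctr', dif_neg hn, dif_pos h']; rw [hch]⟩
  -- the multiset of the new coordinate members decreases
  set kidsM : Multiset (State K × Finset (Fin 4)) :=
    Pl.val.map fun e => (CentreBlowup.step p S₁ e.1 e.2.1 s₁, e.2.2) with hkidsM
  have hkidsF_map : kidsF.val.map (fun d => (cst' d, ctr' d)) = kidsM := by
    have hinj' : Set.InjOn kid ↑Pl := fun e he e' he' h => hkid_inj e he e' he' h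
    rw [hkidsF, Finset.image_val_of_injOn hinj', Multiset.map_map, hkidsM]
    refine Multiset.map_congr rfl fun e he => ?_
    obtain ⟨h1, h2⟩ := hkid_rep e (Finset.mem_val.mp he)
    change (cst' (kid e), ctr' (kid e)) = _
    rw [h1, h2]
  have hsurvF_map : survF.val.map (fun d => (cst' d, ctr' d)) = (cms.erase c₁).val.map (fun c => (cst c, ctr c)) := by
    rw [hsurvF, Finset.image_val_of_injOn hprei_inj, Multiset.map_map]
    refine Multiset.map_congr rfl fun c hc => ?_
    obtain ⟨h1, h2⟩ := hsurv_rep c (Finset.mem_val.mp hc)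
    change (cst' (prei c), ctr' (prei c)) = _
    rw [h1, h2]
  have hT'split : cms'.val.map (fun d => (cst' d, ctr' d)) = kidsM + (cms.erase c₁).val.map (fun c => (cst c, ctr c)) := by
    rw [← hkidsF_map, ← hsurvF_map, ← Multiset.map_add]
    rfl
  have hTsplit : T = (s₁, S₁) ::ₘ (cms.erase c₁).val.map (fun c => (cst c, ctr c)) := by
    rw [← hTeq, ← Multiset.map_cons (fun c => (cst c, ctr c)) c₁, Finset.erase_val,
      Multiset.cons_erase (Finset.mem_val.mpr hc₁)]
  have hcut : Relation.CutExpand (fun q' q : State K × Finset (Fin 4) =>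
      (∃ e ∈ plan q.1 q.2, q' = (CentreBlowup.step p q.2 e.1 e.2.1 q.1, e.2.2)) ∧ q' ≠ q)
      (cms'.val.map (fun d => (cst' d, ctr' d))) T := by
    refine ⟨kidsM, (s₁, S₁), fun a ha => ?_, ?_⟩
    · rw [hkidsM, Multiset.mem_map] at ha
      obtain ⟨e, he, rfl⟩ := ha
      have hrel : ∃ e' ∈ plan s₁ S₁, (CentreBlowup.step p S₁ e.1 e.2.1 s₁, e.2.2) =
          (CentreBlowup.step p S₁ e'.1 e'.2.1 s₁, e'.2.2) := ⟨e, Finset.mem_val.mp he, rfl⟩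
      exact ⟨hrel, fun heq => not_rel_self_of_acc hacc₁ ⟨e, Finset.mem_val.mp he, heq.symm⟩⟩
    · rw [hT'split, hTsplit, ← Multiset.singleton_add]
      abel
  -- recurse on the new stage
  refine ih _ hcut (blowup Ce) (blowup.π Ce ≫ σ) M'' h₁ pts' st' (fun w hw => ?_) (fun w hw => ?_) cms' cst' ctr'
    rfl (fun d hd => ?_) (fun d hd d' hd' hdd => ?_) (fun w hw d hd => ?_) (fun z hz hzo => ?_)
  · -- closedness of the point members
    rcases (hmem' w).mp hw with hw | hw
    · exact ((hmem_over w).mp hw).1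
    · have hz := (hmem_surv w).mp hw
      exact isClosed_singleton_of_not_mem_support hπ (hclosed _ hz) ((hCsupp _).mpr (hdisj₂ _ hz c₁ hc₁))
  · -- data of the point members
    rcases (hmem' w).mp hw with hw | hw
    · obtain ⟨l, hl, hst'w, hl1, hl2, heq, Y', φ', ψ', _, _, y', hφ', hψ', hMw⟩ := hover w hw
      obtain ⟨haccl, hfinl⟩ := hP3 l hl heq
      rw [hst'w]
      refine ⟨step_F_ne_zero_of_isClean hl1 l.2 s₁ hF₁ hclean₁ hS₁.2, isClean_step S₁ l.1 l.2 s₁,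
        ordAlong_univ_step_of_isEquimultiplePoint' S₁ l.1 l.2 s₁ heq, haccl, fun s' hs' => ?_, Y', φ', ψ',
        inferInstance, inferInstance, y', hφ', hψ', hMw⟩
      exact finite_closedOver_model_of_finite_pairs s'
        (ordAlong_univ_of_reflTransGen_edge (ordAlong_univ_step_of_isEquimultiplePoint' S₁ l.1 l.2 s₁ heq) hs')
        (hfinl s' hs')
    · have hz := (hmem_surv w).mp hw
      obtain ⟨hFz, hcleanz, hpermz, haccz, hlocfinz, Yz, φz, ψz, _, _, yz, hφz, hψz, hMz⟩ := hdata _ hz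
      have hnot : blowup.π Ce w ∉ (Ce.support : Set X') := (hCsupp _).mpr (hdisj₂ _ hz c₁ hc₁)
      obtain ⟨Y', φ', ψ', _, _, y', hφ', hψ', hMw⟩ :=
        exists_zigzag_comap_controlledTransform_of_not_mem_support hπ hnot φz ψz yz hφz hψz M'.ideal
          (hypSheaf p (st (blowup.π Ce w)).F) hMz M'.mult (w := w) rfl
      rw [hoff w (hdisj₂ _ hz c₁ hc₁)]
      exact ⟨hFz, hcleanz, hpermz, haccz, hlocfinz, Y', φ', ψ', inferInstance, inferInstance, y', hφ', hψ',
        by rw [hM''I]; exact hMw⟩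
  · -- data of the coordinate members: children and survivors
    rcases (hmem_cms' d).mp hd with ⟨e, he, rfl⟩ | ⟨c, hc, rfl⟩
    · obtain ⟨hcst, hctr⟩ := hkid_rep e he
      rw [hcst, hctr]
      obtain ⟨hreg, hsnc, hzig, -, -⟩ := hkid e he
      obtain ⟨hj, hbj, hsub, heq, hperm''⟩ := hP1 e he
      refine ⟨step_F_ne_zero_of_isClean hj e.2.1 s₁ hF₁ hclean₁ hS₁.2, isClean_step S₁ e.1 e.2.1 s₁, hperm'', hreg,
        hsnc, hzig, fun q hq => hplan₁ q (Relation.ReflTransGen.head ⟨e, he, rfl⟩ hq), hacc₁.inv ⟨e, he, rfl⟩⟩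
    · obtain ⟨hcst, hctr⟩ := hsurv_rep c hc
      rw [hcst, hctr]
      obtain ⟨hFc, hcleanc, hSc, hregc, hsncc, ⟨Yc, φc, ψc, _, _, hMc, hZc, hcφc, hseec, idxc, cstc, hshapec, hinjc⟩,
        hplanc, haccc⟩ := hcdata c (Finset.mem_of_mem_erase hc)
      obtain ⟨hreg', -, hsnc'⟩ := member_survival_global hπ M' c (hdisjC c hc) hregc
        (coe_member_subset_support φc ψc M' hmult' _ hMc hSc.2 c hZc hcφc) hsnc₁ hsncc
      obtain ⟨Y', φ', ψ', _, _, hM', hZ', hcφ', hsee', idx₂, cst₂, hshape₂, hinj₂⟩ :=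
        member_survival_zigzag_shape hπ c (hdisjC c hc) φc ψc M'.ideal (hypSheaf p (cst c).F) hMc M'.mult hZc hcφc hseec
          M'.boundary idxc cstc hshapec hinjc
      exact ⟨hFc, hcleanc, hSc, hreg', hsnc', ⟨Y', φ', ψ', inferInstance, inferInstance,
        by rw [hM''I]; exact hM', hZ', hcφ', hsee', idx₂, cst₂, hshape₂, hinj₂⟩, hplanc, haccc⟩
  · -- the coordinate members are pairwise disjoint
    rcases (hmem_cms' d).mp hd with ⟨e, he, rfl⟩ | ⟨c, hc, rfl⟩
    · rcases (hmem_cms' d').mp hd' with ⟨e', he', rfl⟩ | ⟨c', hc', rfl⟩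
      · exact hkdisj e he e' he' fun h => hdd (by rw [h])
      · rw [Set.disjoint_left]
        intro w hw hw'
        exact Set.disjoint_left.mp (hdisj₁ c' (Finset.mem_of_mem_erase hc') c₁ hc₁ (Finset.ne_of_mem_erase hc'))
          hw' (hkid_over e he w hw)
    · rcases (hmem_cms' d').mp hd' with ⟨e', he', rfl⟩ | ⟨c', hc', rfl⟩
      · rw [Set.disjoint_left]
        intro w hw hw'
        exact Set.disjoint_left.mp (hdisj₁ c (Finset.mem_of_mem_erase hc) c₁ hc₁ (Finset.ne_of_mem_erase hc))
          hw (hkid_over e' he' w hw')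
      · have hcc : c ≠ c' := fun h => hdd (by rw [h])
        exact (hdisj₁ c (Finset.mem_of_mem_erase hc) c' (Finset.mem_of_mem_erase hc') hcc).preimage _
  · -- point members avoid coordinate members
    rcases (hmem_cms' d).mp hd with ⟨e, he, rfl⟩ | ⟨c, hc, rfl⟩
    · rcases (hmem' w).mp hw with hw | hw
      · exact ((hmem_over w).mp hw).2.2.2 e he
      · exact fun h => hdisj₂ _ ((hmem_surv w).mp hw) c₁ hc₁ (hkid_over e he w h)
    · change blowup.π Ce w ∉ (c : Set X')
      rcases (hmem' w).mp hw with hw | hw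
      · exact fun h => Set.disjoint_left.mp (hdisj₁ c (Finset.mem_of_mem_erase hc) c₁ hc₁ (Finset.ne_of_mem_erase hc))
          h ((hmem_over w).mp hw).2.1
      · exact hdisj₂ _ ((hmem_surv w).mp hw) c (Finset.mem_of_mem_erase hc)
  · -- every closed order-`p` point of the new stage is a member
    by_cases hzx : blowup.π Ce z ∈ (c₁ : Set X')
    · by_cases hk : ∃ e ∈ Pl, z ∈ (kid e : Set (blowup Ce))
      · obtain ⟨e, he, hze⟩ := hk
        exact Or.inr ⟨kid e, (hmem_cms' _).mpr (Or.inl ⟨e, he, rfl⟩), hze⟩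
      · push Not at hk
        exact Or.inl ((hmem' z).mpr (Or.inl ((hmem_over z).mpr ⟨hz, hzx, hzo, hk⟩)))
    · have hzo' : (p : ℕ∞) ≤ idealOrder M'.ideal (blowup.π Ce z) := by rw [← hsurv_ord z hzx]; exact hzo
      rcases hcover _ (isClosed_singleton_π' hπ hz) hzo' with h | ⟨c, hc, hzc⟩
      · exact Or.inl ((hmem' z).mpr (Or.inr ((hmem_surv z).mpr h)))
      · have hcc : c ≠ c₁ := fun h => hzx (by rw [← h]; exact hzc)
        exact Or.inr ⟨prei c, (hmem_cms' _).mpr (Or.inr ⟨c, Finset.mem_erase.mpr ⟨hcc, hc⟩, rfl⟩), hzc⟩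

end Forest

end Equimultiple

end Summit.ResolutionOfSingularities.ResolutionOfSingularities.Theorems.PIDim4

end
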